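import Literature.MathematicalPhysics.QuantumFieldTheory.Balaban1983to89.B13CoerciveAlongPencil
import Literature.MathematicalPhysics.QuantumFieldTheory.Balaban1983to89.Node00.OpsYDeltaALocal

/-!
# `Balaban1983to89.B13DirichletLocalCoerciveBall` — T. Bałaban, *Propagators for lattice gauge theories in a background field*, Commun. Math. Phys. **99** (1985)
389–434 [Balaban1985BackgroundPropagators], Thm 3.11 p. 416 («the operators Δ′_a, G′, (Q′G′²Q′\*)⁻¹, Δ_a, G are positive definite … In [4] we have proved that the operator
G_□(1) is positive … Cor. 3.6»), Cor. 3.6 p. 408, Sect. C pp. 408–409 («for the sequence {Ω_n(□)} … G′_□(U), C_□(U), G_□(U)»), Thm 3.4 p. 400 («we prove quantitative statements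
which are more precise, describing these analytic extensions as small perturbations of the operators depending on U only»), (3.35)–(3.37) p. 396, Thm 3.10 (3.107)–(3.108)
p. 416; *Renormalization group approach to lattice gauge field theories. II*, Commun. Math. Phys. **116** (1988) 1–22 [Balaban1988RG2Cluster] p. 15: STATION L5 OF THE LOCAL-CUBE
ROAD — THEOREM 3.11's LOCAL CLAUSE `Δ_{a,□}(U) > 0` (node00-def-Y's compressed local operator `padDeltaALocY`) IS OPEN ALONG THE PENCIL: on a located chart ball around
every coercive centre, in particular around every pure gauge — dag-n06-j's row-17 binder `hloc` in BALL FORM.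

statement-level bookkeeping over LANDED theorems with citation tags; kernel-checked; positional applications of module 83; nothing here is a claim about the Yang–Mills mass
gap; nothing of Bałaban's operators is asserted beyond the cited tree theorems; no node is discharged; count-neutral.

WHY THIS FILE (cell `pub-ymgap`, HUMAN RULING D-0062, Track A node N10 = [Balaban1988RG2Cluster] → N06 row 17; width seat `pub-ymgap-dag-n10-w3` g5, road declarer; lane
word dag-n10-c g16 «OFFER-3 GO … L5 = n06-j's literal `hloc` shape», socket spec dag-n06-j g23 (a)–(c), bus 2026-08-28).  dag-n06-j's `posDefTr_padDeltaALocY_of_cubeGauge_smallness`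
(p628894) derives row 17's local clause at `U^u` from the ONE displayed input (iii) — a sup-norm smallness of `(T(1) − T(U^u))T(1)⁻¹`.  THIS FILE replaces (iii) by module 83's
ABSOLUTE-smallness ball: from the compressed local operator's pencil letters (station L4, `B13DirichletLocalDeltaALetters.rawEntryLetters_toMatrix_padDeltaALocY_prodCfg`, DISPLAYED
here as `hA`) and ONE displayed number — the centre's coercivity constant `m_□` — Theorem 3.11's clause holds at `e^{iηA′}U₀` for every `‖A′‖ < r_□`,
`r_□ = R′` any radius with `2·(B·(m_F·c₀(1,ρ)^ν))·R′ < m_□·R`.  At `U₀ = 1` this is dag-n06-j's `hloc` slot VERBATIM, (a) centre `1`, (b) `D ∕ χP ∕ χ` generic (the 0∕1 and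
«χ-bonds start in □̃» hypotheses of F2 enter only through `m_□`, which at `U₀ = 1` is a theorem per member: F2∕F3 `posDefTr_padDeltaALocY_one(_cubeDomY)` + dag-n06-j §0
`exists_pos_coer_of_posDefTr`), (c) the radius as LOCATED in `(m_□, B, m_F, ρ, R)`: in the plain sup-norm chart `R = O(1)∕(|η|·(d+2)·L^k)` (the averaging transports), so the
closing comparison with (3.35)'s cube-gauge bound `‖A‖ < c·M·α₀·(L^jη)⁻¹` (r06 `Reg335Cube`) is k-uniform on top-index cubes `j = k`; the all-index k-uniform edition is the SAME
theorem at a (3.37)-scaled pencil (later instance).  What then remains for Cor. 3.6 ∕ row 17 on (3.35): (α) that closing inequality + the cube-axial-gauge representation (dag-n06-j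
CLAIM-3 `B9Eq335CubeDomCoverP` + node00-def-Y A-3 locality `OpsYDeltaALocalAgree`), (β) the volume-uniform `m_□` ([4] Sect. B∕C), (γ) the (3.105) remainder `θ < 1` — none here.

WHAT THIS FILE PROVES (all `theorem`s; no `def`, no instance, no notation).
§1 (ANY `parS parB D P`, ANY bond-cut operator `PB`, ANY background `U₀`) ★★ `trIP_padDeltaALocY_prodCfg_ge_of_coer_centre` (coercivity `m_□ − 2·(B·(m_F·c₀(1,ρ)^ν))·R′∕R` on the ball
   `‖A′‖ < R′`), ★★★ `posDefTr_padDeltaALocY_prodCfg_of_coer_centre` (Theorem 3.11's local clause on the located ball).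
§2 THE `hloc` SHAPE: ★★★ `posDefTr_padDeltaALocY_prodCfg_of_sup_lt` (the ball as «`∀ μ z, ‖A′ μ z‖ < R′`», any `U₀`), ★★★ `posDefTr_padDeltaALocY_parSymY_prodCfg_one_of_sup_lt`
   (v4 letters, centre `U₀ = 1`, cuts `cutMulY χP ∕ cutMulY χ`: LITERALLY `∀ A′, (∀ μ z, ‖A′ μ z‖ < R′) → PosDefTr (fun _ => (1:ℝ)) (padDeltaALocY i (parSymY i) (parBY i) D
   (cutMulY χP) (cutMulY χ) (prodCfg 1 η A′))`).
HONEST FRAMING: count-neutral Literature helper; the letters `hA` (stations L1–L4) and the centre's `m_□` DISPLAYED; a CHART ball about `U₀`, NOT the class (3.35); nothing of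
[Balaban1985BackgroundPropagators] Thm 3.3 ∕ 3.11 ∕ Cor. 3.6 asserted; N06 ∕ N10 NOT discharged; no registered stub proved; counts unmoved; one finite 𝕋⁴ programme at fixed ε —
R4 closes the conditional finite-𝕋⁴ rung `BalabanLadder.UV` only; nothing continuum ∕ ℝ⁴ ∕ OS ∕ mass gap ∕ Clay.  0 `sorry`, 0 `def`, standard axioms.

References: [Balaban1985BackgroundPropagators] (3.26)–(3.27) p.395, (3.35)–(3.37) p.396, Thm 3.3 p.399, Thm 3.4 p.400, Cor. 3.6 p.408, Sect. C pp.408–409, (3.105) p.414,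
Thm 3.10 (3.107)–(3.108) pp.415–416, Thm 3.11 p.416; [Balaban1988RG2Cluster] (2.5)–(2.7) pp.12–13, p.15, (2.16) p.16; [Balaban1984PropagatorsII] Lemma 2.1 (2.61) p.234, Lemma 2.4.
-/

noncomputable section

namespace Literature.MathematicalPhysics.QuantumFieldTheory.Balaban1983to89.B13DirichletLocalCoerciveBall

open Metric Set Finset Module
open scoped Matrix Matrix.Norms.L2Operator
open Literature.MathematicalPhysics.QuantumFieldTheory.Balaban1983to89
open Literature.MathematicalPhysics.QuantumFieldTheory.Balaban1983to89.B9Thm37GlueTorus (tdist1)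
open Literature.MathematicalPhysics.QuantumFieldTheory.Balaban1983to89.B5TorusCover (UT)
open Literature.MathematicalPhysics.QuantumFieldTheory.Balaban1983to89.B9Thm311ReadingCoords (trIP PosDefTr)
open Literature.MathematicalPhysics.QuantumFieldTheory.Balaban1983to89.B13EntrywiseWalks (RawEntryLetters)
open Literature.MathematicalPhysics.QuantumFieldTheory.Balaban1983to89.B13CoerciveAlongPencil (coer_ball_of_coer_centre_letters posDefTr_ball_of_coer_centre_letters)
open Literature.MathematicalPhysics.QuantumFieldTheory.Balaban1983to89.B9Thm37CubeCoverCommutators (cutMulY)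
open Literature.MathematicalPhysics.QuantumFieldTheory.Balaban1983to89.B9Eq39Adjoint (prodCfg)
open Literature.MathematicalPhysics.QuantumFieldTheory.Balaban1983to89.B9Eq369Product (prodCfg_zero)
open Literature.MathematicalPhysics.QuantumFieldTheory.Balaban1983to89.B6GlobalChartV1 (PV)
open Literature.MathematicalPhysics.QuantumFieldTheory.Balaban1983to89.B6KLevelCensusIndexV1 (KIdx)
open Literature.MathematicalPhysics.QuantumFieldTheory.Balaban1983to89.Node00
open Literature.MathematicalPhysics.QuantumFieldTheory.Balaban1983to89.Node00.OpsYDeltaALocal (padDeltaALocY)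

variable {d ℓ : ℕ} {hd : 1 ≤ d + 1} {hL : Odd (ℓ + 1) ∧ 1 < ℓ + 1} {b₀ b₁ : ℝ}
variable (i : KIdx d ℓ hd hL b₀ b₁) {N : ℕ}
variable {ν : ℕ} {Nf : Fin ν → ℕ} [∀ j, NeZero (Nf j)]

/-! ## §1. Theorem 3.11's local clause along the pencil, on the located ball about a coercive centre -/

section Ball

/-- ★★ **COERCIVITY OF THE COMPRESSED LOCAL OPERATOR ALONG THE PENCIL** (ANY `parS parB D P PB U₀`): `padDeltaALocY`'s pencil letters `hA` (`(R, ρ, B)`, `0 < ρ`, station L4), a fibre bound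
`m_F`, the centre's coercivity `m_□·⟨Ψ,Ψ⟩₁ ≤ ⟨Ψ, Δ^{pad}_{a,□}(U₀)Ψ⟩₁`, `0 ≤ R′ ≤ R` ⟹ for every `‖A′‖ < R′`:
`(m_□ − 2·(B·(m_F·c₀(1,ρ)^ν))·R′∕R)·⟨Ψ,Ψ⟩₁ ≤ ⟨Ψ, Δ^{pad}_{a,□}(e^{iηA′}U₀)Ψ⟩₁` — module 83 `coer_ball_of_coer_centre_letters` at the compressed local operator.
[cite: Balaban1985BackgroundPropagators, Sect. C pp.408–409 (G_□(U)), Thm 3.4 p.400, (3.62)–(3.64) p.402, Thm 3.10 (3.108) p.416, Thm 3.11 p.416; Balaban1988RG2Cluster, p.15, (2.16) p.16;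
Balaban1984PropagatorsII, Lemma 2.1 (2.61) p.234] -/
theorem trIP_padDeltaALocY_prodCfg_ge_of_coer_centre (parS : SiteParY (Matrix (Fin N) (Fin N) ℂ) i) (parB : BondParY (Matrix (Fin N) (Fin N) ℂ) i)
    (D : Finset (SiteY i)) (P : Module.End ℂ (BlkY i → Matrix (Fin N) (Fin N) ℂ)) (PB : Module.End ℂ (FBondY i → Matrix (Fin N) (Fin N) ℂ))
    (U₀ : CfgY (Matrix (Fin N) (Fin N) ℂ) i) (η : ℝ) {loc : FBondY i × (Fin N × Fin N) → UT Nf} {R R' ρ B m : ℝ}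
    (hA : RawEntryLetters (fun a : Fin (d + 1) → Site (PV d ℓ i.m i.K hd hL) 0 → Matrix (Fin N) (Fin N) ℂ =>
      LinearMap.toMatrix
        ((Pi.basis fun _ : FBondY i => Matrix.stdBasis ℂ (Fin N) (Fin N)).reindex (Equiv.sigmaEquivProd (FBondY i) (Fin N × Fin N)))
        ((Pi.basis fun _ : FBondY i => Matrix.stdBasis ℂ (Fin N) (Fin N)).reindex (Equiv.sigmaEquivProd (FBondY i) (Fin N × Fin N)))
        (padDeltaALocY i parS parB D P PB (prodCfg U₀ η a))) loc R ρ B)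
    (hρ : 0 < ρ) {mF : ℕ} (hfib : ∀ y : UT Nf, (univ.filter fun k => loc k = y).card ≤ mF)
    (hco : ∀ Ψ : FBondY i → Matrix (Fin N) (Fin N) ℂ,
      m * trIP (fun _ => (1 : ℝ)) Ψ Ψ ≤ trIP (fun _ => (1 : ℝ)) Ψ (padDeltaALocY i parS parB D P PB U₀ Ψ))
    (hR' : 0 ≤ R') (hR'R : R' ≤ R) :
    ∀ a ∈ ball (0 : Fin (d + 1) → Site (PV d ℓ i.m i.K hd hL) 0 → Matrix (Fin N) (Fin N) ℂ) R', ∀ Ψ : FBondY i → Matrix (Fin N) (Fin N) ℂ,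
      (m - 2 * (B * (mF * B6.c0 1 ρ ^ ν)) * R' / R) * trIP (fun _ => (1 : ℝ)) Ψ Ψ ≤
        trIP (fun _ => (1 : ℝ)) Ψ (padDeltaALocY i parS parB D P PB (prodCfg U₀ η a) Ψ) := by
  have hco0 : ∀ Ψ : FBondY i → Matrix (Fin N) (Fin N) ℂ,
      m * trIP (fun _ => (1 : ℝ)) Ψ Ψ ≤ trIP (fun _ => (1 : ℝ)) Ψ (padDeltaALocY i parS parB D P PB (prodCfg U₀ η 0) Ψ) := by
    intro Ψ; rw [prodCfg_zero]; exact hco Ψ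
  -- the family argument of module 83 is left to unification (`_`), see L1's kernel note
  exact coer_ball_of_coer_centre_letters _ hA hρ hfib hco0 hR' hR'R

/-- ★★★ **THEOREM 3.11's LOCAL CLAUSE ON THE LOCATED BALL** (ANY `parS parB D P PB U₀`): under the same letters, if `2·(B·(m_F·c₀(1,ρ)^ν))·R′ < m_□·R` then
`PosDefTr 1 (Δ^{pad}_{a,□}(e^{iηA′}U₀))` for every `‖A′‖ < R′` — module 83 `posDefTr_ball_of_coer_centre_letters` at the compressed local operator.
[cite: Balaban1985BackgroundPropagators, Thm 3.11 p.416, Cor. 3.6 p.408, Sect. C pp.408–409, Thm 3.4 p.400, (3.108) p.416; Balaban1988RG2Cluster, p.15] -/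
theorem posDefTr_padDeltaALocY_prodCfg_of_coer_centre (parS : SiteParY (Matrix (Fin N) (Fin N) ℂ) i) (parB : BondParY (Matrix (Fin N) (Fin N) ℂ) i)
    (D : Finset (SiteY i)) (P : Module.End ℂ (BlkY i → Matrix (Fin N) (Fin N) ℂ)) (PB : Module.End ℂ (FBondY i → Matrix (Fin N) (Fin N) ℂ))
    (U₀ : CfgY (Matrix (Fin N) (Fin N) ℂ) i) (η : ℝ) {loc : FBondY i × (Fin N × Fin N) → UT Nf} {R R' ρ B m : ℝ}
    (hA : RawEntryLetters (fun a : Fin (d + 1) → Site (PV d ℓ i.m i.K hd hL) 0 → Matrix (Fin N) (Fin N) ℂ =>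
      LinearMap.toMatrix
        ((Pi.basis fun _ : FBondY i => Matrix.stdBasis ℂ (Fin N) (Fin N)).reindex (Equiv.sigmaEquivProd (FBondY i) (Fin N × Fin N)))
        ((Pi.basis fun _ : FBondY i => Matrix.stdBasis ℂ (Fin N) (Fin N)).reindex (Equiv.sigmaEquivProd (FBondY i) (Fin N × Fin N)))
        (padDeltaALocY i parS parB D P PB (prodCfg U₀ η a))) loc R ρ B)
    (hρ : 0 < ρ) {mF : ℕ} (hfib : ∀ y : UT Nf, (univ.filter fun k => loc k = y).card ≤ mF)
    (hco : ∀ Ψ : FBondY i → Matrix (Fin N) (Fin N) ℂ,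
      m * trIP (fun _ => (1 : ℝ)) Ψ Ψ ≤ trIP (fun _ => (1 : ℝ)) Ψ (padDeltaALocY i parS parB D P PB U₀ Ψ))
    (hR' : 0 ≤ R') (hR'R : R' ≤ R) (hsmall : 2 * (B * (mF * B6.c0 1 ρ ^ ν)) * R' < m * R) :
    ∀ a ∈ ball (0 : Fin (d + 1) → Site (PV d ℓ i.m i.K hd hL) 0 → Matrix (Fin N) (Fin N) ℂ) R',
      PosDefTr (fun _ => (1 : ℝ)) (padDeltaALocY i parS parB D P PB (prodCfg U₀ η a)) := by
  have hco0 : ∀ Ψ : FBondY i → Matrix (Fin N) (Fin N) ℂ,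
      m * trIP (fun _ => (1 : ℝ)) Ψ Ψ ≤ trIP (fun _ => (1 : ℝ)) Ψ (padDeltaALocY i parS parB D P PB (prodCfg U₀ η 0) Ψ) := by
    intro Ψ; rw [prodCfg_zero]; exact hco Ψ
  exact posDefTr_ball_of_coer_centre_letters _ hA hρ hfib hco0 hR' hR'R hsmall

end Ball

/-! ## §2. The `hloc` shape: the ball as «`∀ μ z, ‖A′ μ z‖ < R′`», and the centre `U₀ = 1` at the v4 letters -/

section Hloc

/-- the sup-norm ball of the pencil chart IS the componentwise condition `∀ μ z, ‖A′ μ z‖ < R′` (`R′ > 0`).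
[cite: Balaban1985BackgroundPropagators, (3.35)–(3.37) p.396 (pointwise bounds on A), bookkeeping] -/
theorem mem_ball_of_sup_lt {A' : Fin (d + 1) → Site (PV d ℓ i.m i.K hd hL) 0 → Matrix (Fin N) (Fin N) ℂ} {R' : ℝ} (hR' : 0 < R')
    (h : ∀ μ z, ‖A' μ z‖ < R') : A' ∈ ball (0 : Fin (d + 1) → Site (PV d ℓ i.m i.K hd hL) 0 → Matrix (Fin N) (Fin N) ℂ) R' := by
  rw [mem_ball_zero_iff, pi_norm_lt_iff hR']
  intro μ
  rw [pi_norm_lt_iff hR']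
  exact h μ

/-- ★★★ **THE `hloc` SHAPE, ANY CENTRE**: under §1's letters, centre coercivity and radius condition (`0 < R′`),
`∀ A′, (∀ μ z, ‖A′ μ z‖ < R′) → PosDefTr 1 (Δ^{pad}_{a,□}(e^{iηA′}U₀))`.
[cite: Balaban1985BackgroundPropagators, Thm 3.11 p.416, Cor. 3.6 p.408, Sect. C pp.408–409, (3.35)–(3.37) p.396, Thm 3.4 p.400; Balaban1988RG2Cluster, p.15] -/
theorem posDefTr_padDeltaALocY_prodCfg_of_sup_lt (parS : SiteParY (Matrix (Fin N) (Fin N) ℂ) i) (parB : BondParY (Matrix (Fin N) (Fin N) ℂ) i)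
    (D : Finset (SiteY i)) (P : Module.End ℂ (BlkY i → Matrix (Fin N) (Fin N) ℂ)) (PB : Module.End ℂ (FBondY i → Matrix (Fin N) (Fin N) ℂ))
    (U₀ : CfgY (Matrix (Fin N) (Fin N) ℂ) i) (η : ℝ) {loc : FBondY i × (Fin N × Fin N) → UT Nf} {R R' ρ B m : ℝ}
    (hA : RawEntryLetters (fun a : Fin (d + 1) → Site (PV d ℓ i.m i.K hd hL) 0 → Matrix (Fin N) (Fin N) ℂ =>
      LinearMap.toMatrix
        ((Pi.basis fun _ : FBondY i => Matrix.stdBasis ℂ (Fin N) (Fin N)).reindex (Equiv.sigmaEquivProd (FBondY i) (Fin N × Fin N)))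
        ((Pi.basis fun _ : FBondY i => Matrix.stdBasis ℂ (Fin N) (Fin N)).reindex (Equiv.sigmaEquivProd (FBondY i) (Fin N × Fin N)))
        (padDeltaALocY i parS parB D P PB (prodCfg U₀ η a))) loc R ρ B)
    (hρ : 0 < ρ) {mF : ℕ} (hfib : ∀ y : UT Nf, (univ.filter fun k => loc k = y).card ≤ mF)
    (hco : ∀ Ψ : FBondY i → Matrix (Fin N) (Fin N) ℂ,
      m * trIP (fun _ => (1 : ℝ)) Ψ Ψ ≤ trIP (fun _ => (1 : ℝ)) Ψ (padDeltaALocY i parS parB D P PB U₀ Ψ))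
    (hR' : 0 < R') (hR'R : R' ≤ R) (hsmall : 2 * (B * (mF * B6.c0 1 ρ ^ ν)) * R' < m * R) :
    ∀ A' : Fin (d + 1) → Site (PV d ℓ i.m i.K hd hL) 0 → Matrix (Fin N) (Fin N) ℂ, (∀ μ z, ‖A' μ z‖ < R') →
      PosDefTr (fun _ => (1 : ℝ)) (padDeltaALocY i parS parB D P PB (prodCfg U₀ η A')) :=
  fun A' hA' => posDefTr_padDeltaALocY_prodCfg_of_coer_centre i parS parB D P PB U₀ η hA hρ hfib hco hR'.le hR'R hsmall A' (mem_ball_of_sup_lt i hR' hA')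

/-- ★★★ **dag-n06-j's `hloc` SLOT IN BALL FORM** (v4 letters `parSymY ∕ parBY`, centre the pure gauge `U₀ = 1`, block cut `cutMulY χP`, bond cut `cutMulY χ`, ANY site set `D`):
from the compressed local operator's pencil letters about `1` (stations L1–L4 at `U₀ = 1`), a fibre bound, the ONE displayed number `m_□` — a coercivity constant of
`Δ^{pad}_{a,□}(1)` (qualitatively a theorem per member: `posDefTr_padDeltaALocY_one_cubeDomY` + `exists_pos_coer_of_posDefTr`; volume-uniform = [4] Sect. B∕C) — and the radius
condition `2·(B·(m_F·c₀(1,ρ)^ν))·R′ < m_□·R`, `0 < R′ ≤ R`: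
`∀ A′, (∀ μ z, ‖A′ μ z‖ < R′) → PosDefTr (fun _ => (1:ℝ)) (padDeltaALocY i (parSymY i) (parBY i) D (cutMulY χP) (cutMulY χ) (prodCfg 1 η A′))` —
the binder `hsmall` ∕ (iii) of `posDefTr_padDeltaALocY_of_cubeGauge_smallness` (p628894) REPLACED by an absolute-smallness ball; transport to every pure gauge `1^u` is F4b
`posDefTr_padDeltaALocY_gaugeY_iff`. [cite: Balaban1985BackgroundPropagators, Thm 3.11 p.416 («In [4] we have proved that the operator G_□(1) is positive»), Cor. 3.6 p.408, Sect. C pp.408–409,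
(3.34)–(3.37) p.396, Thm 3.4 p.400; Balaban1988RG2Cluster, p.15; Balaban1984PropagatorsII, Lemma 2.4] -/
theorem posDefTr_padDeltaALocY_parSymY_prodCfg_one_of_sup_lt (D : Finset (SiteY i)) (χP : BlkY i → ℝ) (χ : FBondY i → ℝ) (η : ℝ)
    {loc : FBondY i × (Fin N × Fin N) → UT Nf} {R R' ρ B m : ℝ}
    (hA : RawEntryLetters (fun a : Fin (d + 1) → Site (PV d ℓ i.m i.K hd hL) 0 → Matrix (Fin N) (Fin N) ℂ =>
      LinearMap.toMatrix
        ((Pi.basis fun _ : FBondY i => Matrix.stdBasis ℂ (Fin N) (Fin N)).reindex (Equiv.sigmaEquivProd (FBondY i) (Fin N × Fin N)))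
        ((Pi.basis fun _ : FBondY i => Matrix.stdBasis ℂ (Fin N) (Fin N)).reindex (Equiv.sigmaEquivProd (FBondY i) (Fin N × Fin N)))
        (padDeltaALocY i (parSymY i) (parBY i) D (cutMulY χP) (cutMulY χ)
          (prodCfg (1 : CfgY (Matrix (Fin N) (Fin N) ℂ) i) η a))) loc R ρ B)
    (hρ : 0 < ρ) {mF : ℕ} (hfib : ∀ y : UT Nf, (univ.filter fun k => loc k = y).card ≤ mF)
    (hco : ∀ Ψ : FBondY i → Matrix (Fin N) (Fin N) ℂ,
      m * trIP (fun _ => (1 : ℝ)) Ψ Ψ ≤ trIP (fun _ => (1 : ℝ)) Ψ (padDeltaALocY i (parSymY i) (parBY i) D (cutMulY χP) (cutMulY χ) 1 Ψ))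
    (hR' : 0 < R') (hR'R : R' ≤ R) (hsmall : 2 * (B * (mF * B6.c0 1 ρ ^ ν)) * R' < m * R) :
    ∀ A' : Fin (d + 1) → Site (PV d ℓ i.m i.K hd hL) 0 → Matrix (Fin N) (Fin N) ℂ, (∀ μ z, ‖A' μ z‖ < R') →
      PosDefTr (fun _ => (1 : ℝ)) (padDeltaALocY i (parSymY i) (parBY i) D (cutMulY χP) (cutMulY χ)
        (prodCfg (1 : CfgY (Matrix (Fin N) (Fin N) ℂ) i) η A')) :=
  -- every operator ∕ cut ∕ background argument is left to unification from `hA` (L1's kernel note: re-elaborated `cutMulY` terms make `isDefEq` unfold pointwise)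
  posDefTr_padDeltaALocY_prodCfg_of_sup_lt i _ _ _ _ _ _ η hA hρ hfib hco hR' hR'R hsmall

end Hloc

end Literature.MathematicalPhysics.QuantumFieldTheory.Balaban1983to89.B13DirichletLocalCoerciveBall
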